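import Literature.NumberTheory.Transcendental.QuadraticRelationsLogarithmsResultantZ
import Literature.NumberTheory.Transcendental.QuadraticRelationsLogarithmsProp35
import Mathlib.Analysis.Complex.ExponentialBounds
import HarnessLib

/-!
# Roy–Waldschmidt 1997, Lemme 3.10

Fifth brick of §3 of D. Roy, M. Waldschmidt, *Approximation diophantienne et indépendance
algébrique de logarithmes*, Ann. Sci. ÉNS (4) 30 (1997), towards Théorème 3.2 (ingredient of the
proof of their Théorème 1.1, whose corollary Théorème 0.2 is the tree's named fact
`Literature.NumberTheory.Transcendental.royWaldschmidt_quadratic_thm_0_2`).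

**Lemme 3.10** (p. 769). "Soient `θ ∈ ℂ`, `δ ∈ ℤ` et `μ, b ∈ ℝ` avec `0 < b ≤ 1/4` et `0 < δ ≤ μ`.
Supposons qu'il existe des polynômes `F, G ∈ ℤ[X]` premiers entre eux, de degré `≤ δ` et de
mesure de Mahler `≤ e^μ`, qui vérifient `dist(θ, Z(F)) ≤ dist(θ, Z(G))` et
`max{|F(θ)|, |G(θ)|} ≤ exp(-bδμ)`. Alors, on a `dist(θ, Z(F)) ≤ exp(-(1/3) b² δ μ)` et
`max{deg F, deg G} ≥ (1/3) b δ`. Si en plus on suppose `deg(F) < (1/3) b δ`, alors on a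
`log |G(θ)| ≥ -3 deg(G) log M(F)`."

PROVED (`RoyWaldschmidt1997.lemme_3_10`, assembled from `lemme_3_10_dist`, `lemme_3_10_log`).
"`dist(θ, Z(F)) ≤ dist(θ, Z(G))`" is rendered by a root `α₀` of `F` at distance `≤` that of every
root of `F` and of `G` (so `dist(θ, Z(F)) = |θ - α₀|`).  Proof as printed: the first assertion
from Proposition 3.5 (`prop_3_5`) with `s = ⌊5.4/b⌋ + 1` and `(log 2) δ² ≤ 0.7 δμ`; the last from
Lemme 3.4 with the single close root `α₀` (a tie-robust replacement of the appeal to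
Proposition 3.6); the second follows.  No definitions, no named facts.

## References

* [RoyWaldschmidt1997ENS] D. Roy, M. Waldschmidt, Ann. Sci. ÉNS (4) 30 (1997) 753–796, §3 (iii)
  Lemme 3.10, p. 769 (lit key paper:doi-10-1016-s0012-9593-97-89938-7, PDF p. 18).
-/

noncomputable section

open Polynomial Multiset

namespace Literature.NumberTheory.Transcendental

namespace RoyWaldschmidt1997

/-- The numerical step of Lemme 3.10 (i): with `s = ⌊5.4/b⌋ + 1` and `0 < b ≤ 1/4`,
`5.4 < sb ≤ 5.65` and `b²/3 ≤ 4(sb - 2.7)/s²`. [folklore] -/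
theorem lemme_3_10_numerics {b : ℝ} (hb0 : 0 < b) (hb : b ≤ 1 / 4) :
    let s : ℕ := ⌊5.4 / b⌋₊ + 1
    5.4 < (s : ℝ) * b ∧ (s : ℝ) * b ≤ 5.65 ∧ b ^ 2 / 3 ≤ (s * b - 2.7) * (4 / (s : ℝ) ^ 2) := by
  intro s
  have hs1 : 5.4 / b < s := by show 5.4 / b < ((⌊5.4 / b⌋₊ + 1 : ℕ) : ℝ); push_cast; exact Nat.lt_floor_add_one _
  have hs2 : (s : ℝ) ≤ 5.4 / b + 1 := by
    show ((⌊5.4 / b⌋₊ + 1 : ℕ) : ℝ) ≤ 5.4 / b + 1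
    push_cast; linarith [Nat.floor_le (by positivity : (0 : ℝ) ≤ 5.4 / b)]
  have hsb1 : 5.4 < s * b := by rwa [div_lt_iff₀ hb0] at hs1
  have hsb2 : (s : ℝ) * b ≤ 5.65 := by
    have h1 : (s : ℝ) * b ≤ 5.4 + b := by
      have := mul_le_mul_of_nonneg_right hs2 hb0.le
      rwa [add_mul, div_mul_cancel₀ _ hb0.ne', one_mul] at this
    linarith
  have hspos : (0 : ℝ) < s := by
    have : (0 : ℝ) < s * b := by linarith
    nlinarith
  refine ⟨hsb1, hsb2, ?_⟩
  set t : ℝ := s * b with ht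
  have ht6 : (t - 6) ^ 2 ≤ 0.36 := by nlinarith
  have hkey : t ^ 2 ≤ 12 * (t - 2.7) := by nlinarith
  have hs2pos : (0 : ℝ) < (s : ℝ) ^ 2 := by positivity
  rw [div_le_iff₀ (by norm_num : (0 : ℝ) < 3),
    show (t - 2.7) * (4 / (s : ℝ) ^ 2) * 3 = (12 * (t - 2.7)) / (s : ℝ) ^ 2 by ring,
    le_div_iff₀ hs2pos]
  calc b ^ 2 * (s : ℝ) ^ 2 = t ^ 2 := by rw [ht]; ring
    _ ≤ 12 * (t - 2.7) := hkey

/-- **Lemme 3.10, first assertion**: under the hypotheses of Lemme 3.10 (complex form: `|lc| ≥ 1`,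
`|Res| ≥ 1`), `dist(θ, Z(F) ∪ Z(G)) ≤ exp(-(1/3) b² δ μ)`.
[cite: RoyWaldschmidt1997ENS, §3 (iii) Lemme 3.10, p. 769] -/
theorem lemme_3_10_dist (θ : ℂ) {δ : ℕ} {b μ : ℝ} (hb0 : 0 < b) (hb : b ≤ 1 / 4) (hδ : 0 < δ)
    (hδμ : (δ : ℝ) ≤ μ) (F G : ℂ[X]) (hF : F ≠ 0) (hG : G ≠ 0)
    (hlcF : 1 ≤ ‖F.leadingCoeff‖) (hlcG : 1 ≤ ‖G.leadingCoeff‖) (hres : 1 ≤ ‖resultant F G‖)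
    (hdF : F.natDegree ≤ δ) (hdG : G.natDegree ≤ δ)
    (hMF : F.mahlerMeasure ≤ Real.exp μ) (hMG : G.mahlerMeasure ≤ Real.exp μ)
    (ρ : ℝ) (hρ0 : 0 ≤ ρ) (hρF : ∀ α ∈ F.roots, ρ ≤ ‖θ - α‖) (hρG : ∀ β ∈ G.roots, ρ ≤ ‖θ - β‖)
    (hsmall : max ‖F.eval θ‖ ‖G.eval θ‖ ≤ Real.exp (-(b * δ * μ))) :
    ρ ≤ Real.exp (-(b ^ 2 * δ * μ / 3)) := by
  have hμpos : 0 < μ := lt_of_lt_of_le (by exact_mod_cast hδ) hδμ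
  have hδpos : (0 : ℝ) < δ := by exact_mod_cast hδ
  have hMF0 : 0 ≤ F.mahlerMeasure := mahlerMeasure_nonneg F
  have hMG0 : 0 ≤ G.mahlerMeasure := mahlerMeasure_nonneg G
  have hexp1 : Real.exp (-(b * δ * μ)) < 1 := Real.exp_lt_one_iff.mpr (by
    have : 0 < b * δ * μ := by positivity
    linarith)
  -- `ρ < 1`
  have hρ1 : ρ < 1 := by
    by_contra h
    push Not at h
    have hmin : min 1 ρ = 1 := min_eq_left h
    have := min_one_pow_le_norm_eval F hlcF θ ρ hρ0 hρF
    rw [hmin, one_pow] at this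
    linarith [(le_max_left _ _).trans hsmall]
  have hminρ : min 1 ρ = ρ := min_eq_right hρ1.le
  obtain ⟨hsb1, hsb2, hkey⟩ := lemme_3_10_numerics hb0 hb
  set s : ℕ := ⌊5.4 / b⌋₊ + 1 with hs
  have hspos : (0 : ℝ) < s := by rw [hs]; positivity
  have h35 := prop_3_5 F G hF hG hlcF hlcG θ (m := δ) (n := δ) hdF hdG ρ hρ0 hρF hρG s
  rw [hminρ] at h35
  have hX : max ‖F.eval θ‖ ‖G.eval θ‖ ^ s ≤ Real.exp (-(b * δ * μ)) ^ s :=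
    pow_le_pow_left₀ (le_max_of_le_left (norm_nonneg _)) hsmall s
  have hstep : ρ ^ ((s : ℝ) ^ 2 / 4) ≤ Real.exp (-((s * b - 2.7) * δ * μ)) := by
    have h1 : ρ ^ ((s : ℝ) ^ 2 / 4) ≤ 2 ^ (δ * δ) * F.mahlerMeasure ^ δ * G.mahlerMeasure ^ δ *
        Real.exp (-(b * δ * μ)) ^ s := by
      calc ρ ^ ((s : ℝ) ^ 2 / 4) = ρ ^ ((s : ℝ) ^ 2 / 4) * 1 := (mul_one _).symm
        _ ≤ ρ ^ ((s : ℝ) ^ 2 / 4) * ‖resultant F G‖ :=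
            mul_le_mul_of_nonneg_left hres (Real.rpow_nonneg hρ0 _)
        _ ≤ _ := h35
        _ ≤ _ := mul_le_mul_of_nonneg_left hX (by positivity)
    have e2 : (2 : ℝ) ^ (δ * δ) = Real.exp (δ * δ * Real.log 2) := by
      rw [← Real.exp_log (by positivity : (0 : ℝ) < 2 ^ (δ * δ)), Real.log_pow]; push_cast; ring_nf
    have eF : F.mahlerMeasure ^ δ ≤ Real.exp (δ * μ) := by
      calc F.mahlerMeasure ^ δ ≤ Real.exp μ ^ δ := pow_le_pow_left₀ hMF0 hMF δ
        _ = Real.exp (δ * μ) := by rw [← Real.exp_nat_mul]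
    have eG : G.mahlerMeasure ^ δ ≤ Real.exp (δ * μ) := by
      calc G.mahlerMeasure ^ δ ≤ Real.exp μ ^ δ := pow_le_pow_left₀ hMG0 hMG δ
        _ = Real.exp (δ * μ) := by rw [← Real.exp_nat_mul]
    have eX : Real.exp (-(b * δ * μ)) ^ s = Real.exp (-(s * (b * δ * μ))) := by
      rw [← Real.exp_nat_mul]; ring_nf
    have hlog2 : Real.log 2 < 0.7 := by have := Real.log_two_lt_d9; linarith
    have hδ2 : (δ : ℝ) * δ * Real.log 2 ≤ 0.7 * δ * μ := by
      have : (δ : ℝ) * δ ≤ δ * μ := mul_le_mul_of_nonneg_left hδμ hδpos.le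
      nlinarith [Real.log_nonneg (by norm_num : (1 : ℝ) ≤ 2)]
    have h2 : (2 : ℝ) ^ (δ * δ) * F.mahlerMeasure ^ δ * G.mahlerMeasure ^ δ * Real.exp (-(b * δ * μ)) ^ s
        ≤ Real.exp (-((s * b - 2.7) * δ * μ)) := by
      calc (2 : ℝ) ^ (δ * δ) * F.mahlerMeasure ^ δ * G.mahlerMeasure ^ δ * Real.exp (-(b * δ * μ)) ^ s
          ≤ Real.exp (δ * δ * Real.log 2) * Real.exp (δ * μ) * Real.exp (δ * μ) *
            Real.exp (-(s * (b * δ * μ))) := by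
            rw [e2, eX]
            gcongr
        _ = Real.exp (δ * δ * Real.log 2 + δ * μ + δ * μ + -(s * (b * δ * μ))) := by
            rw [← Real.exp_add, ← Real.exp_add, ← Real.exp_add]
        _ ≤ Real.exp (-((s * b - 2.7) * δ * μ)) := Real.exp_le_exp.mpr (by nlinarith)
    exact h1.trans h2
  -- extract the `s²/4`-th root
  have hexp4 : (0 : ℝ) < 4 / (s : ℝ) ^ 2 := by positivity
  have hroot := Real.rpow_le_rpow (Real.rpow_nonneg hρ0 _) hstep hexp4.le
  rw [← Real.rpow_mul hρ0, show (s : ℝ) ^ 2 / 4 * (4 / (s : ℝ) ^ 2) = 1 by field_simp,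
    Real.rpow_one, ← Real.exp_mul] at hroot
  refine hroot.trans (Real.exp_le_exp.mpr ?_)
  have hδμ0 : 0 ≤ (δ : ℝ) * μ := by positivity
  have := mul_le_mul_of_nonneg_right hkey hδμ0
  nlinarith

/-- **Lemme 3.10, last assertion (complex form)**: if moreover `deg F < (1/3) b δ` and `α₀` is a
root of `F` at distance `≤` that of all roots of `G`, then
`log |G(θ)| ≥ -3 deg(G) log M(F)` (and `|G(θ)| > 0`).
[cite: RoyWaldschmidt1997ENS, §3 (iii) Lemme 3.10, p. 769] -/
theorem lemme_3_10_log (θ : ℂ) {δ : ℕ} {b μ : ℝ} (hδμ : (δ : ℝ) ≤ μ)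
    (F G : ℂ[X]) (hF : F ≠ 0) (hG : G ≠ 0) (hres : 1 ≤ ‖resultant F G‖)
    (hdG : G.natDegree ≤ δ) (hM1F : 1 ≤ F.mahlerMeasure) (hM1G : 1 ≤ G.mahlerMeasure)
    (hMG : G.mahlerMeasure ≤ Real.exp μ)
    (α₀ : ℂ) (hα₀ : α₀ ∈ F.roots) (hα₀G : ∀ β ∈ G.roots, ‖θ - α₀‖ ≤ ‖θ - β‖)
    (hGsmall : ‖G.eval θ‖ ≤ Real.exp (-(b * δ * μ))) (hdeg : (F.natDegree : ℝ) < b * δ / 3) :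
    0 < ‖G.eval θ‖ ∧ -3 * G.natDegree * Real.log F.mahlerMeasure ≤ Real.log ‖G.eval θ‖ := by
  have h34 := resultant_wirsing F G hF hG θ {α₀} 0 (Multiset.singleton_le.mpr hα₀)
    (Multiset.zero_le _) 0 le_rfl (fun _ _ => norm_nonneg _) (fun _ _ => norm_nonneg _)
    (fun α hα β hβ => by
      rw [Multiset.mem_singleton.mp hα]; rw [tsub_zero] at hβ; exact hα₀G β hβ)
    (fun β hβ => absurd hβ (Multiset.notMem_zero β))
  simp only [card_singleton, card_zero, mul_zero, pow_zero, one_mul, tsub_zero, pow_one,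
    mul_one] at h34
  set m := F.natDegree with hm
  set n := G.natDegree with hn
  have hMF0 : 0 < F.mahlerMeasure := one_pos.trans_le hM1F
  have hMG0 : 0 < G.mahlerMeasure := one_pos.trans_le hM1G
  have h1 : 1 ≤ 2 ^ (m * n) * F.mahlerMeasure ^ n * G.mahlerMeasure ^ (m - 1) * ‖G.eval θ‖ :=
    hres.trans h34
  have hGpos : 0 < ‖G.eval θ‖ := by
    rcases (norm_nonneg (G.eval θ)).eq_or_lt with h0 | h0
    · rw [← h0, mul_zero] at h1; linarith
    · exact h0
  refine ⟨hGpos, ?_⟩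
  have hlog := Real.log_le_log one_pos h1
  rw [Real.log_one, Real.log_mul (by positivity) hGpos.ne', Real.log_mul (by positivity) (by positivity),
    Real.log_mul (by positivity) (by positivity), Real.log_pow, Real.log_pow, Real.log_pow,
    Nat.cast_mul] at hlog
  have hlogMG : Real.log G.mahlerMeasure ≤ μ := by
    have := Real.log_le_log hMG0 hMG; rwa [Real.log_exp] at this
  have hlogMF0 : 0 ≤ Real.log F.mahlerMeasure := Real.log_nonneg hM1F
  have hlogMG0 : 0 ≤ Real.log G.mahlerMeasure := Real.log_nonneg hM1G
  have hm1 : ((m - 1 : ℕ) : ℝ) ≤ m := by exact_mod_cast Nat.sub_le m 1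
  have hnδ : (n : ℝ) ≤ δ := by exact_mod_cast hdG
  have hm0 : (0 : ℝ) ≤ m := Nat.cast_nonneg _
  have hδ0 : (0 : ℝ) ≤ δ := Nat.cast_nonneg _
  have hμ0 : 0 ≤ μ := hδ0.trans hδμ
  have hlog2 : Real.log 2 < 0.7 := by have := Real.log_two_lt_d9; linarith
  have hlog20 : 0 ≤ Real.log 2 := Real.log_nonneg (by norm_num)
  have hA : (m : ℝ) * n * Real.log 2 + ((m - 1 : ℕ) : ℝ) * Real.log G.mahlerMeasure ≤
      2 / 3 * (b * δ * μ) := by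
    have t1 : (m : ℝ) * n * Real.log 2 ≤ m * (δ * 0.7) := by
      rw [mul_assoc]; exact mul_le_mul_of_nonneg_left (by nlinarith) hm0
    have t2 : ((m - 1 : ℕ) : ℝ) * Real.log G.mahlerMeasure ≤ m * μ :=
      (mul_le_mul_of_nonneg_right hm1 hlogMG0).trans (mul_le_mul_of_nonneg_left hlogMG hm0)
    have t3 : (m : ℝ) * (0.7 * δ + μ) ≤ (b * δ / 3) * (0.7 * δ + μ) :=
      mul_le_mul_of_nonneg_right hdeg.le (by positivity)
    nlinarith
  have hB : Real.log ‖G.eval θ‖ ≤ -(b * δ * μ) := by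
    have := Real.log_le_log hGpos hGsmall; rwa [Real.log_exp] at this
  nlinarith

/-- **Roy–Waldschmidt 1997, Lemme 3.10.**  See the module docstring for the statement; `α₀` is a
root of `F` closest to `θ` among all roots of `F` and `G` (rendering "`dist(θ,Z(F)) ≤ dist(θ,Z(G))`",
with `dist(θ, Z(F)) = |θ - α₀|`). [cite: RoyWaldschmidt1997ENS, §3 (iii) Lemme 3.10, p. 769] -/
theorem lemme_3_10 (θ : ℂ) {δ : ℕ} {b μ : ℝ} (hb0 : 0 < b) (hb : b ≤ 1 / 4) (hδ : 0 < δ)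
    (hδμ : (δ : ℝ) ≤ μ) (F G : ℤ[X]) (hF : F ≠ 0) (hG : G ≠ 0)
    (hcop : IsCoprime (F.map (Int.castRingHom ℚ)) (G.map (Int.castRingHom ℚ)))
    (hdF : F.natDegree ≤ δ) (hdG : G.natDegree ≤ δ)
    (hMF : (F.map (Int.castRingHom ℂ)).mahlerMeasure ≤ Real.exp μ)
    (hMG : (G.map (Int.castRingHom ℂ)).mahlerMeasure ≤ Real.exp μ)
    (α₀ : ℂ) (hα₀ : α₀ ∈ (F.map (Int.castRingHom ℂ)).roots)
    (hα₀F : ∀ α ∈ (F.map (Int.castRingHom ℂ)).roots, ‖θ - α₀‖ ≤ ‖θ - α‖)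
    (hα₀G : ∀ β ∈ (G.map (Int.castRingHom ℂ)).roots, ‖θ - α₀‖ ≤ ‖θ - β‖)
    (hsmall : max ‖aeval θ F‖ ‖aeval θ G‖ ≤ Real.exp (-(b * δ * μ))) :
    ‖θ - α₀‖ ≤ Real.exp (-(b ^ 2 * δ * μ / 3)) ∧
    (b * δ / 3 ≤ max (F.natDegree : ℝ) G.natDegree) ∧
    ((F.natDegree : ℝ) < b * δ / 3 →
      -3 * G.natDegree * Real.log (F.map (Int.castRingHom ℂ)).mahlerMeasure ≤ Real.log ‖aeval θ G‖) := by
  set Fc := F.map (Int.castRingHom ℂ) with hFc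
  set Gc := G.map (Int.castRingHom ℂ) with hGc
  have hFc0 : Fc ≠ 0 := (Polynomial.map_ne_zero_iff (RingHom.injective_int _)).mpr hF
  have hGc0 : Gc ≠ 0 := (Polynomial.map_ne_zero_iff (RingHom.injective_int _)).mpr hG
  have hmC : Fc.natDegree = F.natDegree := natDegree_map_eq_of_injective (RingHom.injective_int _) _
  have hnC : Gc.natDegree = G.natDegree := natDegree_map_eq_of_injective (RingHom.injective_int _) _
  have hFθ : ‖Fc.eval θ‖ = ‖aeval θ F‖ := by rw [hFc, eval_map, ← algebraMap_int_eq, ← aeval_def]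
  have hGθ : ‖Gc.eval θ‖ = ‖aeval θ G‖ := by rw [hGc, eval_map, ← algebraMap_int_eq, ← aeval_def]
  have hlcF : 1 ≤ ‖Fc.leadingCoeff‖ := by
    rw [hFc, leadingCoeff_map_of_injective (RingHom.injective_int _), eq_intCast, Complex.norm_intCast]
    exact_mod_cast Int.one_le_abs (leadingCoeff_ne_zero.mpr hF)
  have hlcG : 1 ≤ ‖Gc.leadingCoeff‖ := by
    rw [hGc, leadingCoeff_map_of_injective (RingHom.injective_int _), eq_intCast, Complex.norm_intCast]
    exact_mod_cast Int.one_le_abs (leadingCoeff_ne_zero.mpr hG)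
  have hM1F : 1 ≤ Fc.mahlerMeasure := one_le_mahlerMeasure_of_ne_zero hF
  have hM1G : 1 ≤ Gc.mahlerMeasure := one_le_mahlerMeasure_of_ne_zero hG
  have hres : 1 ≤ ‖resultant Fc Gc‖ := one_le_norm_resultant_map F G hcop
  have hμpos : 0 < μ := lt_of_lt_of_le (by exact_mod_cast hδ) hδμ
  have hsmall' : max ‖Fc.eval θ‖ ‖Gc.eval θ‖ ≤ Real.exp (-(b * δ * μ)) := by rwa [hFθ, hGθ]
  have hGsmall : ‖Gc.eval θ‖ ≤ Real.exp (-(b * δ * μ)) := (le_max_right _ _).trans hsmall'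
  refine ⟨?_, ?_, ?_⟩
  · exact lemme_3_10_dist θ hb0 hb hδ hδμ Fc Gc hFc0 hGc0 hlcF hlcG hres (hmC ▸ hdF) (hnC ▸ hdG)
      hMF hMG ‖θ - α₀‖ (norm_nonneg _) hα₀F hα₀G hsmall'
  · by_cases hdeg : (F.natDegree : ℝ) < b * δ / 3
    · obtain ⟨hGpos, h3⟩ := lemme_3_10_log θ hδμ Fc Gc hFc0 hGc0 hres (hnC ▸ hdG) hM1F hM1G hMG
        α₀ hα₀ hα₀G hGsmall (hmC.symm ▸ hdeg)
      rw [hnC] at h3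
      have hB : Real.log ‖Gc.eval θ‖ ≤ -(b * δ * μ) := by
        have := Real.log_le_log hGpos hGsmall; rwa [Real.log_exp] at this
      have hlogMF : Real.log Fc.mahlerMeasure ≤ μ := by
        have := Real.log_le_log (one_pos.trans_le hM1F) hMF; rwa [Real.log_exp] at this
      have hn0 : (0 : ℝ) ≤ G.natDegree := Nat.cast_nonneg _
      have h4 : b * δ * μ ≤ 3 * G.natDegree * μ := by nlinarith
      have h5 : b * δ ≤ 3 * G.natDegree := le_of_mul_le_mul_right (by linarith) hμpos
      have : b * δ / 3 ≤ G.natDegree := by linarith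
      exact this.trans (le_max_right _ _)
    · push Not at hdeg
      exact hdeg.trans (le_max_left _ _)
  · intro hdeg
    obtain ⟨-, h3⟩ := lemme_3_10_log θ hδμ Fc Gc hFc0 hGc0 hres (hnC ▸ hdG) hM1F hM1G hMG
      α₀ hα₀ hα₀G hGsmall (hmC.symm ▸ hdeg)
    rwa [hnC, hGθ] at h3

end RoyWaldschmidt1997

end Literature.NumberTheory.Transcendental
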